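import Summits.QuantumFields.YangMills.Theorems.AllWindowsColdBoxBulkMidSandwichLocalisedCeiling
import Summits.QuantumFields.YangMills.Theorems.AllWindowsColdBoxBulkMidSandwichLocalisedFloor
import Summits.QuantumFields.YangMills.Theorems.AllWindowsColdBoxBulkMidSandwichLocalisedBLH0

/-!
# WHITENING of the localised variance pinching: from the frame `H₀ = 1` to every `H₀ ≻ 0`
# (crux idea `logconcave-core-extension` on ⟨stmt-QuantumFields-24006⟩ — the card's IDEA-NEEDED leaf
# «localised QCC on a convex body at the intrinsic `r_K`»)

`pinching_localised_posDef`: for `H₀ ≻ 0`, `0 ≤ δ_K ≤ δ ≤ ½`, `H` symmetric, `b`, `A ∈ C²(ℝⁿ)` with the GLOBAL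
second-difference sandwich `(1 ± δ)·hᵀH₀h`, the centring `∫x_i e^{−A} = 0`, and on a measurable core `K` the
Hessian pinching `(1 − δ_K)vᵀH₀v ≤ D²A(x)(v,v) ≤ (1 + δ_K)vᵀH₀v`:

  `(1 − 17ρ)·rV ≤ gE(q²) − gE(q)² ≤ (1 + 168ρ)·rV`,
  `rV = 2 tr(H₀⁻¹HH₀⁻¹H) + bᵀH₀⁻¹b`,  `ρ = δ_K + δ·(∫_{Kᶜ}e^{−A}/∫e^{−A})^{1/4}`

— conjugation by `P = H₀^{1/2}` (`exists_symm_sqrt`, `sandwich_conj`, `hess_conj`, `centring_conj`,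
`integral_div_comp_mulVec`, `quadObs_conj`, `trace_conj_mul_conj`, `conj_dotProduct_conj`); the core becomes the
preimage `P·K` and the off-core Gibbs mass ratio is frame invariant.

HONEST SCOPE.  Free-hands work of the LEAD seat of ⟨stmt-QuantumFields-24006⟩ (FCL lineage) on an ingredient
of an UN-TRIAGED crux idea card; classical log-concave probability.  No stub of LINE-18, no crux, rung or
summit is proved; the Yang–Mills mass gap is NOT proved by any of this.
-/

noncomputable section

namespace Summit.QuantumFields.YangMills.Theorems.SandwichVariancePinching

open MeasureTheory Real Matrix Set
open Summit.QuantumFields.YangMills.Cruxes.TransportCovarianceTransfer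

variable {n : ℕ}

/-- **THE LOCALISED VARIANCE PINCHING IN THE `H₀` METRIC** (floor and ceiling): see the module docstring.
[folklore] -/
theorem pinching_localised_posDef {H₀ : Matrix (Fin n) (Fin n) ℝ} (hH₀ : H₀.PosDef)
    {δ : ℝ} (hδ : 0 ≤ δ) (hδ2 : δ ≤ 1 / 2)
    (H : Matrix (Fin n) (Fin n) ℝ) (b : Fin n → ℝ) {A : (Fin n → ℝ) → ℝ} (hH : H.IsSymm)
    (hA : ContDiff ℝ 2 A)
    (hsw : ∀ x h : Fin n → ℝ, (1 - δ) * (h ⬝ᵥ H₀ *ᵥ h) ≤ A (x + h) + A (x - h) - 2 * A x ∧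
      A (x + h) + A (x - h) - 2 * A x ≤ (1 + δ) * (h ⬝ᵥ H₀ *ᵥ h))
    (hcent : ∀ i : Fin n, ∫ x, x i * exp (-A x) = 0)
    {K : Set (Fin n → ℝ)} (hK : MeasurableSet K) {δK : ℝ} (hδK : 0 ≤ δK) (hδKδ : δK ≤ δ)
    (hloc : ∀ x ∈ K, ∀ v : Fin n → ℝ, (1 - δK) * (v ⬝ᵥ H₀ *ᵥ v) ≤ fderiv ℝ (fderiv ℝ A) x v v ∧
      fderiv ℝ (fderiv ℝ A) x v v ≤ (1 + δK) * (v ⬝ᵥ H₀ *ᵥ v)) :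
    (1 - 17 * (δK + δ * Real.sqrt (Real.sqrt ((∫ x in Kᶜ, exp (-A x)) / ∫ x, exp (-A x))))) *
        (2 * (H₀⁻¹ * H * H₀⁻¹ * H).trace + b ⬝ᵥ H₀⁻¹ *ᵥ b) ≤
      (∫ x, (x ⬝ᵥ H *ᵥ x + b ⬝ᵥ x) * (x ⬝ᵥ H *ᵥ x + b ⬝ᵥ x) * exp (-A x)) / (∫ x, exp (-A x)) -
        (∫ x, (x ⬝ᵥ H *ᵥ x + b ⬝ᵥ x) * exp (-A x)) / (∫ x, exp (-A x)) *
          ((∫ x, (x ⬝ᵥ H *ᵥ x + b ⬝ᵥ x) * exp (-A x)) / (∫ x, exp (-A x))) ∧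
    (∫ x, (x ⬝ᵥ H *ᵥ x + b ⬝ᵥ x) * (x ⬝ᵥ H *ᵥ x + b ⬝ᵥ x) * exp (-A x)) / (∫ x, exp (-A x)) -
        (∫ x, (x ⬝ᵥ H *ᵥ x + b ⬝ᵥ x) * exp (-A x)) / (∫ x, exp (-A x)) *
          ((∫ x, (x ⬝ᵥ H *ᵥ x + b ⬝ᵥ x) * exp (-A x)) / (∫ x, exp (-A x))) ≤
      (1 + 168 * (δK + δ * Real.sqrt (Real.sqrt ((∫ x in Kᶜ, exp (-A x)) / ∫ x, exp (-A x))))) *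
        (2 * (H₀⁻¹ * H * H₀⁻¹ * H).trace + b ⬝ᵥ H₀⁻¹ *ᵥ b) := by
  have hδ1 : δ < 1 := by linarith
  obtain ⟨P, hPs, hP, hPP⟩ := exists_symm_sqrt hH₀
  have hQs : P⁻¹.IsSymm := isSymm_inv hPs
  have hQQ : P⁻¹ * P⁻¹ = H₀⁻¹ := by rw [← Matrix.mul_inv_rev, hPP]
  have hQdet : (P⁻¹).det ≠ 0 := by
    rw [Matrix.det_nonsing_inv, Ring.inverse_eq_inv']
    exact inv_ne_zero hP
  -- the whitened potential, its sandwich, smoothness, centring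
  set At : (Fin n → ℝ) → ℝ := fun y => A (P⁻¹ *ᵥ y) with hAt
  have hAt2 : ContDiff ℝ 2 At := hA.comp (Matrix.mulVecLin P⁻¹).toContinuousLinearMap.contDiff
  have hswt : ∀ y k : Fin n → ℝ, (1 - δ) * (k ⬝ᵥ k) ≤ At (y + k) + At (y - k) - 2 * At y ∧
      At (y + k) + At (y - k) - 2 * At y ≤ (1 + δ) * (k ⬝ᵥ k) := fun y k =>
    sandwich_conj hPs hP hPP hsw y k
  have hmom := sandwichMoments_of_lt_one δ hδ hδ1 n H₀ A hH₀ hA.continuous hsw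
  have hint : ∀ i : Fin n, Integrable fun x : Fin n → ℝ => x i * exp (-A x) := fun i => by
    have h := (hmom.2.2 0 0 (Pi.single i 1) 0).1
    refine h.congr (ae_of_all _ fun x => ?_)
    simp [Matrix.zero_mulVec]
  have hcentt : ∀ i : Fin n, ∫ y, y i * exp (-At y) = 0 := fun i => centring_conj hP hint hcent i
  -- the whitened core and its Hessian pinching
  set Kt : Set (Fin n → ℝ) := (fun y => P⁻¹ *ᵥ y) ⁻¹' K with hKt
  have hKtm : MeasurableSet Kt :=
    hK.preimage (Matrix.mulVecLin P⁻¹).toContinuousLinearMap.continuous.measurable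
  have hloct : ∀ y ∈ Kt, ∀ u : Fin n → ℝ, (1 - δK) * (u ⬝ᵥ u) ≤ fderiv ℝ (fderiv ℝ At) y u u ∧
      fderiv ℝ (fderiv ℝ At) y u u ≤ (1 + δK) * (u ⬝ᵥ u) := by
    intro y hy u
    have h := hloc (P⁻¹ *ᵥ y) hy (P⁻¹ *ᵥ u)
    rw [quadForm_inv_mulVec hPs hP hPP] at h
    have e := hess_conj hA P⁻¹ y u
    simp only [hAt]
    rw [e]
    exact h
  -- the off-core mass ratio is frame invariant
  have hratio : (∫ y in Ktᶜ, exp (-At y)) / (∫ y, exp (-At y)) = (∫ x in Kᶜ, exp (-A x)) / ∫ x, exp (-A x) := by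
    rw [← integral_indicator hKtm.compl, ← integral_indicator hK.compl]
    simp only [hAt]
    -- `Ktᶜ.indicator (e^{−A∘P⁻¹}) y` is definitionally `Kᶜ.indicator (e^{−A}) (P⁻¹ y)` (preimage membership)
    exact integral_div_comp_mulVec hQdet (fun x => Kᶜ.indicator (fun x => exp (-A x)) x) (fun x => exp (-A x))
  -- the whitened floor and ceiling
  have hfl := floorWhitened_localised hδ hδ2 (P⁻¹ * H * P⁻¹) (P⁻¹ *ᵥ b) (isSymm_conj hQs hH) hAt2 hswt hcentt
    hKtm hδK hδKδ hloct
  have hce := ceilingWhitened_localised hδ hδ2 (P⁻¹ * H * P⁻¹) (P⁻¹ *ᵥ b) (isSymm_conj hQs hH) hAt2 hswt hcentt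
    hKtm hδK hδKδ hloct
  rw [hratio, trace_conj_mul_conj _ _ _ _ hQQ, conj_dotProduct_conj hQs hQQ] at hfl hce
  simp only [quadObs_conj hQs, hAt] at hfl hce
  have r1 := integral_div_comp_mulVec hQdet
    (fun x => (x ⬝ᵥ H *ᵥ x + b ⬝ᵥ x) * (x ⬝ᵥ H *ᵥ x + b ⬝ᵥ x) * exp (-A x)) (fun x => exp (-A x))
  have r2 := integral_div_comp_mulVec hQdet
    (fun x => (x ⬝ᵥ H *ᵥ x + b ⬝ᵥ x) * exp (-A x)) (fun x => exp (-A x))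
  rw [r1, r2] at hfl hce
  exact ⟨hfl, hce⟩

end Summit.QuantumFields.YangMills.Theorems.SandwichVariancePinching

end
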